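import Summits.KontsevichZagierPeriods.KontsevichZagierPeriods.Theorems.HeckeMultiplicityOneManinStokesHalfPlaneGreen
import Summits.KontsevichZagierPeriods.KontsevichZagierPeriods.Theorems.ComplexOrientationsCauchyMoveCircle
import Summits.KontsevichZagierPeriods.KontsevichZagierPeriods.Theorems.HeckeMultiplicityOneManinStokesTileRamanujan

/-!
# `ManinStokes` (stmt-KontsevichZagierPeriods-5277): Cauchy's theorem on the lower half plane inside
# the KZ calculus, as three edge representations

Support file (prover-owned, `--supports stmt-KontsevichZagierPeriods-5277`; generic in `G`). For `G` continuous
on the closed lower half plane off `{0, 1728}`, holomorphic inside, decaying at infinity, with `re G`, `im G`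
`ℚ`-semialgebraic, `G'` integrable on the open lower half plane and `G` integrable on the three edges
`(1728, ∞)`, `(0, 1728)`, `(−∞, 0)`: there are edge representations `a, b, c` over these intervals with
integrands `re G`, `im G` or `−im G` with `[a] + [b] + [c] ∈ KZ.relations` (`green_re_halfPlane`, then the
change of variables `u = x(t)` (`cov1`) and domain additivity). Reference: M. Kontsevich, D. Zagier, *Periods*
(2001), §1.2 rules (1)–(3). No definitions, no named facts.
-/

noncomputable section

open Set MeasureTheory Filter Topology
open Literature.NumberTheory.Transcendental Literature.ModelTheory.ExponentialFields

namespace Summit.KontsevichZagierPeriods.HeckeMultiplicityOne.ManinStokes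

/-! ## From Green on the rectangle to Cauchy on the three real intervals `(−∞,0)`, `(0,1728)`, `(1728,∞)` -/

section ThreeEdges

open Summit.KontsevichZagierPeriods.ComplexOrientations.CauchyMoveAux (cov1)

variable {G : ℂ → ℂ}


/-- A `ℚ`-semialgebraic function of `(re u, im u)` on the punctured closed lower half plane restricts to a
`ℚ`-semialgebraic function of the real variable on `ℝ ∖ {0, 1728}` (composition with `u ↦ (u, 0)`). [folklore] -/
theorem isSemialgebraicFunOn_realLine {F : (Fin 2 → ℝ) → ℝ}
    (hF : IsSemialgebraicFunOn ℚ {w : Fin 2 → ℝ | w 1 ≤ 0 ∧ ¬(w 0 = 0 ∧ w 1 = 0) ∧ ¬(w 0 = 1728 ∧ w 1 = 0)} F)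
    {S : Set (Fin 1 → ℝ)} (hS : IsSemialgebraic ℚ S) (hS0 : ∀ u ∈ S, u 0 ≠ 0 ∧ u 0 ≠ 1728) :
    IsSemialgebraicFunOn ℚ S (fun u => F ![u 0, 0]) := by
  have hmap : IsSemialgebraicMapOn ℚ S (fun u : Fin 1 → ℝ => (![u 0, 0] : Fin 2 → ℝ)) := by
    refine IsSemialgebraicMapOn.of_forall hS fun l => ?_
    fin_cases l
    · simpa using (isSemialgebraicFunOn_aeval hS (MvPolynomial.X 0)).congr fun u _ => by simp
    · simpa using (isSemialgebraicFunOn_aeval hS (0 : MvPolynomial (Fin 1) ℚ)).congr fun u _ => by simp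
  refine IsSemialgebraicFunOn.comp_isSemialgebraicMapOn_holds hF hmap fun u hu => ?_
  refine ⟨by simp, ?_, ?_⟩
  · simpa using (hS0 u hu).1
  · simpa using (hS0 u hu).2

/-- The three real intervals and the punctured line are `ℚ`-semialgebraic subsets of `ℝ¹`. [folklore] -/
theorem isSemialgebraic_intervals :
    IsSemialgebraic ℚ {u : Fin 1 → ℝ | u 0 < 0} ∧ IsSemialgebraic ℚ {u : Fin 1 → ℝ | u 0 ∈ Ioo (0 : ℝ) 1728} ∧
      IsSemialgebraic ℚ {u : Fin 1 → ℝ | 1728 < u 0} ∧ IsSemialgebraic ℚ {u : Fin 1 → ℝ | u 0 ≠ 0 ∧ u 0 ≠ 1728} := by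
  have h1 := isSemialgebraic_setOf_eval_pos (k := ℚ) (R := ℝ) (-MvPolynomial.X (0 : Fin 1) : MvPolynomial (Fin 1) ℚ)
  have h2 := isSemialgebraic_setOf_eval_pos (k := ℚ) (R := ℝ) (MvPolynomial.X (0 : Fin 1) : MvPolynomial (Fin 1) ℚ)
  have h3 := isSemialgebraic_setOf_eval_pos (k := ℚ) (R := ℝ) (MvPolynomial.C (1728 : ℚ) - MvPolynomial.X (0 : Fin 1) : MvPolynomial (Fin 1) ℚ)
  have h4 := isSemialgebraic_setOf_eval_pos (k := ℚ) (R := ℝ) (MvPolynomial.X (0 : Fin 1) - MvPolynomial.C (1728 : ℚ) : MvPolynomial (Fin 1) ℚ)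
  have h5 := isSemialgebraic_setOf_eval_ne_zero (k := ℚ) (R := ℝ) (MvPolynomial.X (0 : Fin 1) : MvPolynomial (Fin 1) ℚ)
  have h6 := isSemialgebraic_setOf_eval_ne_zero (k := ℚ) (R := ℝ) (MvPolynomial.X (0 : Fin 1) - MvPolynomial.C (1728 : ℚ) : MvPolynomial (Fin 1) ℚ)
  refine ⟨?_, ?_, ?_, ?_⟩
  · have he : {u : Fin 1 → ℝ | u 0 < 0} = {u | 0 < MvPolynomial.aeval u (-MvPolynomial.X (0 : Fin 1) : MvPolynomial (Fin 1) ℚ)} := by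
      ext u; simp
    rw [he]; exact h1
  · have he : {u : Fin 1 → ℝ | u 0 ∈ Ioo (0 : ℝ) 1728} = {u | 0 < MvPolynomial.aeval u (MvPolynomial.X (0 : Fin 1) : MvPolynomial (Fin 1) ℚ)} ∩
        {u | 0 < MvPolynomial.aeval u (MvPolynomial.C (1728 : ℚ) - MvPolynomial.X (0 : Fin 1) : MvPolynomial (Fin 1) ℚ)} := by
      ext u; simp [sub_pos]
    rw [he]; exact h2.inter h3
  · have he : {u : Fin 1 → ℝ | 1728 < u 0} = {u | 0 < MvPolynomial.aeval u (MvPolynomial.X (0 : Fin 1) - MvPolynomial.C (1728 : ℚ) : MvPolynomial (Fin 1) ℚ)} := by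
      ext u; simp [sub_pos]
    rw [he]; exact h4
  · have he : {u : Fin 1 → ℝ | u 0 ≠ 0 ∧ u 0 ≠ 1728} = {u | MvPolynomial.aeval u (MvPolynomial.X (0 : Fin 1) : MvPolynomial (Fin 1) ℚ) ≠ 0} ∩
        {u | MvPolynomial.aeval u (MvPolynomial.X (0 : Fin 1) - MvPolynomial.C (1728 : ℚ) : MvPolynomial (Fin 1) ℚ) ≠ 0} := by
      ext u; simp [sub_eq_zero]
    rw [he]; exact h5.inter h6

/-- **Cauchy's theorem on the lower half plane as three edge representations in `KZ.relations`.** Let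
`G` satisfy the hypotheses of `green_re_halfPlane` and be absolutely integrable on the three real intervals
`(−∞,0)`, `(0,1728)`, `(1728,∞)`. Then for a real-linear part `ℓ ∈ {re}` hmm — here `re` — there are
representations `a, b, c` over `(1728,∞)`, `(0,1728)`, `(−∞,0)` with integrands `re G` whose formal sum lies
in `KZ.relations`: `green_re_halfPlane`, the substitution `u = x(t)` (rule (2), `cov1`), and domain additivity.
[cite: KontsevichZagierPeriods2001, §1.2 rules (1)–(3)] -/
theorem cauchy_three_edges_re
    (hGc : ContinuousOn G {u : ℂ | u.im ≤ 0 ∧ u ≠ 0 ∧ u ≠ 1728})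
    (hGd : DifferentiableOn ℂ G {u : ℂ | u.im < 0})
    (hGdecay : ∀ ε > 0, ∃ R, ∀ u : ℂ, u.im ≤ 0 → R ≤ ‖u‖ → ‖G u‖ ≤ ε)
    (hGre : IsSemialgebraicFunOn ℚ {w : Fin 2 → ℝ | w 1 ≤ 0 ∧ ¬(w 0 = 0 ∧ w 1 = 0) ∧ ¬(w 0 = 1728 ∧ w 1 = 0)}
      (fun w => (G ((w 0 : ℂ) + (w 1 : ℂ) * Complex.I)).re))
    (hGim : IsSemialgebraicFunOn ℚ {w : Fin 2 → ℝ | w 1 ≤ 0 ∧ ¬(w 0 = 0 ∧ w 1 = 0) ∧ ¬(w 0 = 1728 ∧ w 1 = 0)}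
      (fun w => (G ((w 0 : ℂ) + (w 1 : ℂ) * Complex.I)).im))
    (hGint : IntegrableOn (fun w : Fin 2 → ℝ => deriv G ((w 0 : ℂ) + (w 1 : ℂ) * Complex.I)) {w | w 1 < 0})
    (hIA : IntegrableOn (fun x : Fin 1 → ℝ => G (x 0)) {x | 1728 < x 0})
    (hIB : IntegrableOn (fun x : Fin 1 → ℝ => G (x 0)) {x | x 0 ∈ Ioo (0 : ℝ) 1728})
    (hIC : IntegrableOn (fun x : Fin 1 → ℝ => G (x 0)) {x | x 0 < 0}) :
    ∃ a b c : KZ.IntegralRep 1,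
      a.domain = {x | 1728 < x 0} ∧ EqOn a.integrand (fun x => (G (x 0)).re) {x | 1728 < x 0} ∧
      b.domain = {x | x 0 ∈ Ioo (0 : ℝ) 1728} ∧ EqOn b.integrand (fun x => (G (x 0)).re) {x | x 0 ∈ Ioo (0 : ℝ) 1728} ∧
      c.domain = {x | x 0 < 0} ∧ EqOn c.integrand (fun x => (G (x 0)).re) {x | x 0 < 0} ∧
      KZ.of a + KZ.of b + KZ.of c ∈ KZ.relations := by
  obtain ⟨hsC, hsB, hsA, hsD⟩ := isSemialgebraic_intervals
  -- the real-line integrand and its three / one representations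
  have hGline : ∀ u : Fin 1 → ℝ,
      (fun v : Fin 1 → ℝ => (G ((((![v 0, (0 : ℝ)] : Fin 2 → ℝ) 0 : ℝ) : ℂ) +
        (((![v 0, (0 : ℝ)] : Fin 2 → ℝ) 1 : ℝ) : ℂ) * Complex.I)).re) u = (G (u 0)).re := by
    intro u; simp
  have hsaA : IsSemialgebraicFunOn ℚ {x : Fin 1 → ℝ | 1728 < x 0} (fun x => (G (x 0)).re) :=
    (isSemialgebraicFunOn_realLine hGre hsA fun u hu => ⟨by linarith [show (1728 : ℝ) < u 0 from hu],
      ne_of_gt hu⟩).congr fun u _ => hGline u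
  have hsaB : IsSemialgebraicFunOn ℚ {x : Fin 1 → ℝ | x 0 ∈ Ioo (0 : ℝ) 1728} (fun x => (G (x 0)).re) :=
    (isSemialgebraicFunOn_realLine hGre hsB fun u hu => ⟨ne_of_gt hu.1, ne_of_lt hu.2⟩).congr fun u _ => hGline u
  have hsaC : IsSemialgebraicFunOn ℚ {x : Fin 1 → ℝ | x 0 < 0} (fun x => (G (x 0)).re) :=
    (isSemialgebraicFunOn_realLine hGre hsC fun u hu => ⟨ne_of_lt hu, by linarith [show u 0 < (0 : ℝ) from hu]⟩).congr
      fun u _ => hGline u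
  have hsaD : IsSemialgebraicFunOn ℚ {x : Fin 1 → ℝ | x 0 ≠ 0 ∧ x 0 ≠ 1728} (fun x => (G (x 0)).re) :=
    (isSemialgebraicFunOn_realLine hGre hsD fun u hu => hu).congr fun u _ => hGline u
  have hIAr' : IntegrableOn (fun x : Fin 1 → ℝ => (G (x 0)).re) {x | 1728 < x 0} := hIA.re
  have hIBr' : IntegrableOn (fun x : Fin 1 → ℝ => (G (x 0)).re) {x | x 0 ∈ Ioo (0 : ℝ) 1728} := hIB.re
  have hICr' : IntegrableOn (fun x : Fin 1 → ℝ => (G (x 0)).re) {x | x 0 < 0} := hIC.re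
  let a : KZ.IntegralRep 1 := ⟨{x | 1728 < x 0}, fun x => (G (x 0)).re, hsA, hsaA, hIAr'⟩
  let b : KZ.IntegralRep 1 := ⟨{x | x 0 ∈ Ioo (0 : ℝ) 1728}, fun x => (G (x 0)).re, hsB, hsaB, hIBr'⟩
  let c : KZ.IntegralRep 1 := ⟨{x | x 0 < 0}, fun x => (G (x 0)).re, hsC, hsaC, hICr'⟩
  -- integrability on the punctured line
  have hID : IntegrableOn (fun x : Fin 1 → ℝ => (G (x 0)).re) {x | x 0 ≠ 0 ∧ x 0 ≠ 1728} := by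
    have hunion : {x : Fin 1 → ℝ | x 0 ≠ 0 ∧ x 0 ≠ 1728} = {x | x 0 < 0} ∪ ({x | x 0 ∈ Ioo (0 : ℝ) 1728} ∪ {x | 1728 < x 0}) := by
      ext x
      simp only [mem_setOf_eq, mem_union, mem_Ioo]
      constructor
      · rintro ⟨h0, h1⟩
        rcases lt_or_gt_of_ne h0 with h | h
        · exact Or.inl h
        · rcases lt_or_gt_of_ne h1 with h' | h'
          · exact Or.inr (Or.inl ⟨h, h'⟩)
          · exact Or.inr (Or.inr h')
      · rintro (h | ⟨h, h'⟩ | h)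
        · exact ⟨ne_of_lt h, by linarith⟩
        · exact ⟨ne_of_gt h, ne_of_lt h'⟩
        · exact ⟨by linarith, ne_of_gt h⟩
    rw [hunion]
    have hICr : IntegrableOn (fun x : Fin 1 → ℝ => (G (x 0)).re) {x | x 0 < 0} := hIC.re
    have hIBr : IntegrableOn (fun x : Fin 1 → ℝ => (G (x 0)).re) {x | x 0 ∈ Ioo (0 : ℝ) 1728} := hIB.re
    have hIAr : IntegrableOn (fun x : Fin 1 → ℝ => (G (x 0)).re) {x | 1728 < x 0} := hIA.re
    exact hICr.union (hIBr.union hIAr)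
  let d : KZ.IntegralRep 1 := ⟨{x | x 0 ≠ 0 ∧ x 0 ≠ 1728}, fun x => (G (x 0)).re, hsD, hsaD, hID⟩
  -- the pulled-back representation on `(−1,1) ∖ {0, x⁻¹(1728)}`
  set x : ℝ → ℝ := fun t => t / (1 - t ^ 2) with hxdef
  set xd : ℝ → ℝ := fun t => (1 + t ^ 2) / (1 - t ^ 2) ^ 2 with hxddef
  have hx : ∀ t, x t = t / (1 - t ^ 2) := fun t => rfl
  have hxd : ∀ t, xd t = (1 + t ^ 2) / (1 - t ^ 2) ^ 2 := fun t => rfl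
  set τv := {t : Fin 1 → ℝ | t 0 ∈ Ioo (-1 : ℝ) 1 ∧ t 0 ≠ 0 ∧ 1728 * (1 - t 0 ^ 2) ≠ t 0} with hτv
  have hτvs : IsSemialgebraic ℚ τv := isSemialgebraic_baseV
  have hximg : (fun z : Fin 1 → ℝ => (fun _ : Fin 1 => x (z 0))) '' τv = {u : Fin 1 → ℝ | u 0 ≠ 0 ∧ u 0 ≠ 1728} := by
    ext u
    simp only [mem_image, mem_setOf_eq]
    constructor
    · rintro ⟨z, ⟨hz, hz0, hz1⟩, rfl⟩
      exact ⟨fun h => hz0 ((xMap_eq_zero_iff hx hz).mp h), fun h => hz1 ((xMap_eq_iff hx hz 1728).mp h)⟩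
    · rintro ⟨h0, h1⟩
      obtain ⟨t, ht, htu⟩ := exists_xMap_eq hx (u 0)
      refine ⟨fun _ => t, ?_, ?_⟩
      · show t ∈ Ioo (-1 : ℝ) 1 ∧ t ≠ 0 ∧ 1728 * (1 - t ^ 2) ≠ t
        exact ⟨ht, fun h => h0 (by rw [← htu, h, hx]; simp), fun h => h1 (by rw [← htu]; exact (xMap_eq_iff hx ht 1728).mpr h)⟩
      · funext i; rw [Subsingleton.elim i 0]; exact htu
  have hxdpos : ∀ t ∈ Ioo (-1 : ℝ) 1, 0 < xd t := fun t ht => by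
    rw [hxd]; exact div_pos (by positivity) (pow_pos (one_sub_sq_pos ht) 2)
  -- integrability of the pulled-back integrand (one-variable substitution, value level)
  have hIτ : IntegrableOn (fun t : Fin 1 → ℝ => (G (x (t 0))).re * xd (t 0)) τv := by
    have hD' : IntegrableOn (fun u : ℝ => (G u).re) {u : ℝ | u ≠ 0 ∧ u ≠ 1728} := by
      have := (integrableOn_fin1_iff (fun u : ℝ => (G u).re) (s := {u : ℝ | u ≠ 0 ∧ u ≠ 1728})).mp
      exact this hID
    set T := {t : ℝ | t ∈ Ioo (-1 : ℝ) 1 ∧ t ≠ 0 ∧ 1728 * (1 - t ^ 2) ≠ t} with hT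
    have hTm : MeasurableSet T := by
      have : T = Ioo (-1 : ℝ) 1 ∩ ({t : ℝ | t ≠ 0} ∩ {t : ℝ | 1728 * (1 - t ^ 2) ≠ t}) := by
        ext t; simp [hT, and_assoc]
      rw [this]
      refine measurableSet_Ioo.inter ((measurableSet_singleton 0).compl.inter ?_)
      exact (isClosed_eq (by fun_prop) continuous_id).measurableSet.compl
    have himgT : x '' T = {u : ℝ | u ≠ 0 ∧ u ≠ 1728} := by
      ext u
      simp only [mem_image, mem_setOf_eq]
      constructor
      · rintro ⟨t, ⟨ht, ht0, ht1⟩, rfl⟩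
        exact ⟨fun h => ht0 ((xMap_eq_zero_iff hx ht).mp h), fun h => ht1 ((xMap_eq_iff hx ht 1728).mp h)⟩
      · rintro ⟨h0, h1⟩
        obtain ⟨t, ht, htu⟩ := exists_xMap_eq hx u
        refine ⟨t, ⟨ht, fun h => h0 ?_, fun h => h1 ?_⟩, htu⟩
        · rw [← htu, h, hx]; simp
        · rw [← htu]; exact (xMap_eq_iff hx ht 1728).mpr h
    rw [← himgT] at hD'
    have key := (integrableOn_image_iff_integrableOn_abs_deriv_smul hTm
      (fun t ht => (hasDerivAt_xMap hx ht.1).hasDerivWithinAt) ((strictMonoOn_xMap hx).injOn.mono fun t ht => ht.1)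
      (fun u : ℝ => (G u).re)).mp hD'
    have key' : IntegrableOn (fun t : ℝ => (G (x t)).re * xd t) T := by
      refine key.congr_fun (fun t ht => ?_) hTm
      simp only [smul_eq_mul]
      rw [abs_of_pos (hxdpos t ht.1 |> fun h => by rwa [hxd] at h), hxd]
      ring
    have := (integrableOn_fin1_iff (fun t : ℝ => (G (x t)).re * xd t) (s := T)).mpr key'
    exact this
  have hsaτ : IsSemialgebraicFunOn ℚ τv (fun t => (G (x (t 0))).re * xd (t 0)) := by
    have hmap : IsSemialgebraicMapOn ℚ τv (fun t : Fin 1 → ℝ => (![x (t 0), (0 : ℝ)] : Fin 2 → ℝ)) := by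
      refine IsSemialgebraicMapOn.of_forall hτvs fun l => ?_
      fin_cases l
      · have h := isSemialgebraicFunOn_aeval_div_aeval hτvs (MvPolynomial.X 0)
          (1 - MvPolynomial.X 0 ^ 2 : MvPolynomial (Fin 1) ℚ) (fun t ht => by simpa using (one_sub_sq_pos ht.1).ne')
        simpa using h.congr fun t _ => by simp [hx]
      · simpa using (isSemialgebraicFunOn_aeval hτvs (0 : MvPolynomial (Fin 1) ℚ)).congr fun u _ => by simp
    have hcomp := IsSemialgebraicFunOn.comp_isSemialgebraicMapOn_holds hGre hmap fun t ht => by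
      refine ⟨by simp, ?_, ?_⟩
      · simpa using fun h => ht.2.1 ((xMap_eq_zero_iff hx ht.1).mp h)
      · simpa using fun h => ht.2.2 ((xMap_eq_iff hx ht.1 1728).mp h)
    have hxdsa : IsSemialgebraicFunOn ℚ τv (fun t => xd (t 0)) := by
      have h := isSemialgebraicFunOn_aeval_div_aeval hτvs (1 + MvPolynomial.X 0 ^ 2)
        ((1 - MvPolynomial.X 0 ^ 2) ^ 2 : MvPolynomial (Fin 1) ℚ) (fun t ht => by simpa using (one_sub_sq_pos ht.1).ne')
      exact h.congr fun t _ => by simp [hxd]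
    exact IsSemialgebraicFunOn.mul_holds (hcomp.congr fun t _ => by simp) hxdsa
  let rB : KZ.IntegralRep 1 := ⟨τv, fun t => (G (x (t 0))).re * xd (t 0), hτvs, hsaτ, hIτ⟩
  -- Green
  have hgreen : KZ.of rB ∈ KZ.relations :=
    green_re_halfPlane (y := fun s => -s / (1 - s)) (yd := fun s => -1 / (1 - s) ^ 2) hx hxd (fun _ => rfl) (fun _ => rfl)
      hGc hGd hGdecay hGre hGim hGint rB rfl fun t _ => rfl
  -- the substitution `u = x(t)` (rule 2)
  have hcov : KZ.of rB - KZ.of d ∈ KZ.relations := by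
    refine cov1 rB d x xd ?_ (fun z hz => hasDerivAt_xMap hx hz.1)
      (fun z hz z' hz' h => (strictMonoOn_xMap hx).injOn hz.1 hz'.1 h) hximg.symm fun z hz => ?_
    · have h := isSemialgebraicFunOn_aeval_div_aeval hτvs (MvPolynomial.X 0)
        (1 - MvPolynomial.X 0 ^ 2 : MvPolynomial (Fin 1) ℚ) (fun t ht => by simpa using (one_sub_sq_pos ht.1).ne')
      exact h.congr fun t _ => by simp [hx]
    · show (G (x (z 0))).re * xd (z 0) = (G (x (z 0))).re * |xd (z 0)|
      rw [abs_of_pos (hxdpos _ hz.1)]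
  -- domain additivity: `d = c + e`, `e = b + a`
  have hsE : IsSemialgebraic ℚ {u : Fin 1 → ℝ | 0 < u 0 ∧ u 0 ≠ 1728} := by
    have h := isSemialgebraic_setOf_eval_pos (k := ℚ) (R := ℝ) (MvPolynomial.X (0 : Fin 1) : MvPolynomial (Fin 1) ℚ)
    have h' := isSemialgebraic_setOf_eval_ne_zero (k := ℚ) (R := ℝ)
      (MvPolynomial.X (0 : Fin 1) - MvPolynomial.C (1728 : ℚ) : MvPolynomial (Fin 1) ℚ)
    have he : {u : Fin 1 → ℝ | 0 < u 0 ∧ u 0 ≠ 1728} =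
        {u | 0 < MvPolynomial.aeval u (MvPolynomial.X (0 : Fin 1) : MvPolynomial (Fin 1) ℚ)} ∩
          {u | MvPolynomial.aeval u (MvPolynomial.X (0 : Fin 1) - MvPolynomial.C (1728 : ℚ) : MvPolynomial (Fin 1) ℚ) ≠ 0} := by
      ext u; simp [sub_eq_zero]
    rw [he]; exact h.inter h'
  let e : KZ.IntegralRep 1 := ⟨{u | 0 < u 0 ∧ u 0 ≠ 1728}, fun x => (G (x 0)).re, hsE,
    hsaD.mono (fun u hu => ⟨ne_of_gt hu.1, hu.2⟩) hsE, hID.mono_set fun u hu => ⟨ne_of_gt hu.1, hu.2⟩⟩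
  have hstep1 : KZ.of d - KZ.of c - KZ.of e ∈ KZ.relations := by
    refine KZ.domainAddRel_subset_relations ⟨1, d, c, e, ?_, ?_, fun _ _ => rfl, fun _ _ => rfl, rfl⟩
    · show {x : Fin 1 → ℝ | x 0 ≠ 0 ∧ x 0 ≠ 1728} = {x | x 0 < 0} ∪ {u | 0 < u 0 ∧ u 0 ≠ 1728}
      ext u
      simp only [mem_setOf_eq, mem_union]
      constructor
      · rintro ⟨h0, h1⟩
        rcases lt_or_gt_of_ne h0 with h | h
        · exact Or.inl h
        · exact Or.inr ⟨h, h1⟩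
      · rintro (h | ⟨h, h1⟩)
        · exact ⟨ne_of_lt h, by linarith⟩
        · exact ⟨ne_of_gt h, h1⟩
    · have : ({x : Fin 1 → ℝ | x 0 < 0} ∩ {u | 0 < u 0 ∧ u 0 ≠ 1728}) = ∅ := by
        ext u; simp only [mem_inter_iff, mem_setOf_eq, mem_empty_iff_false, iff_false]
        rintro ⟨h1, h2, _⟩; linarith
      show volume ({x : Fin 1 → ℝ | x 0 < 0} ∩ {u | 0 < u 0 ∧ u 0 ≠ 1728}) = 0
      rw [this, measure_empty]
  have hstep2 : KZ.of e - KZ.of b - KZ.of a ∈ KZ.relations := by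
    refine KZ.domainAddRel_subset_relations ⟨1, e, b, a, ?_, ?_, fun _ _ => rfl, fun _ _ => rfl, rfl⟩
    · show {u : Fin 1 → ℝ | 0 < u 0 ∧ u 0 ≠ 1728} = {x | x 0 ∈ Ioo (0 : ℝ) 1728} ∪ {x | 1728 < x 0}
      ext u
      simp only [mem_setOf_eq, mem_union, mem_Ioo]
      constructor
      · rintro ⟨h0, h1⟩
        rcases lt_or_gt_of_ne h1 with h | h
        · exact Or.inl ⟨h0, h⟩
        · exact Or.inr h
      · rintro (⟨h, h'⟩ | h)
        · exact ⟨h, ne_of_lt h'⟩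
        · exact ⟨by linarith, ne_of_gt h⟩
    · have : ({x : Fin 1 → ℝ | x 0 ∈ Ioo (0 : ℝ) 1728} ∩ {x | 1728 < x 0}) = ∅ := by
        ext u; simp only [mem_inter_iff, mem_setOf_eq, mem_empty_iff_false, iff_false, mem_Ioo]
        rintro ⟨⟨_, h2⟩, h3⟩; linarith
      show volume ({x : Fin 1 → ℝ | x 0 ∈ Ioo (0 : ℝ) 1728} ∩ {x | 1728 < x 0}) = 0
      rw [this, measure_empty]
  refine ⟨a, b, c, rfl, fun _ _ => rfl, rfl, fun _ _ => rfl, rfl, fun _ _ => rfl, ?_⟩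
  have hd : KZ.of d ∈ KZ.relations := by
    have := KZ.relations.sub_mem hgreen hcov
    rwa [sub_sub_cancel] at this
  have h := KZ.relations.sub_mem (KZ.relations.sub_mem hd hstep1) hstep2
  convert h using 1
  abel

/-- `re (−i z) = im z` and `im (−i z) = −re z`. [folklore] -/
theorem re_neg_I_mul (z : ℂ) : (-Complex.I * z).re = z.im ∧ (-Complex.I * z).im = -z.re := by
  constructor <;> simp [Complex.mul_re, Complex.mul_im]

/-- **Cauchy on the lower half plane, imaginary parts**: the same three edge representations with
integrands `im G` (apply `cauchy_three_edges_re` to `−i G`). [cite: KontsevichZagierPeriods2001, §1.2 rules (1)–(3)] -/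
theorem cauchy_three_edges_im
    (hGc : ContinuousOn G {u : ℂ | u.im ≤ 0 ∧ u ≠ 0 ∧ u ≠ 1728})
    (hGd : DifferentiableOn ℂ G {u : ℂ | u.im < 0})
    (hGdecay : ∀ ε > 0, ∃ R, ∀ u : ℂ, u.im ≤ 0 → R ≤ ‖u‖ → ‖G u‖ ≤ ε)
    (hGre : IsSemialgebraicFunOn ℚ {w : Fin 2 → ℝ | w 1 ≤ 0 ∧ ¬(w 0 = 0 ∧ w 1 = 0) ∧ ¬(w 0 = 1728 ∧ w 1 = 0)}
      (fun w => (G ((w 0 : ℂ) + (w 1 : ℂ) * Complex.I)).re))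
    (hGim : IsSemialgebraicFunOn ℚ {w : Fin 2 → ℝ | w 1 ≤ 0 ∧ ¬(w 0 = 0 ∧ w 1 = 0) ∧ ¬(w 0 = 1728 ∧ w 1 = 0)}
      (fun w => (G ((w 0 : ℂ) + (w 1 : ℂ) * Complex.I)).im))
    (hGint : IntegrableOn (fun w : Fin 2 → ℝ => deriv G ((w 0 : ℂ) + (w 1 : ℂ) * Complex.I)) {w | w 1 < 0})
    (hIA : IntegrableOn (fun x : Fin 1 → ℝ => G (x 0)) {x | 1728 < x 0})
    (hIB : IntegrableOn (fun x : Fin 1 → ℝ => G (x 0)) {x | x 0 ∈ Ioo (0 : ℝ) 1728})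
    (hIC : IntegrableOn (fun x : Fin 1 → ℝ => G (x 0)) {x | x 0 < 0}) :
    ∃ a b c : KZ.IntegralRep 1,
      a.domain = {x | 1728 < x 0} ∧ EqOn a.integrand (fun x => (G (x 0)).im) {x | 1728 < x 0} ∧
      b.domain = {x | x 0 ∈ Ioo (0 : ℝ) 1728} ∧ EqOn b.integrand (fun x => (G (x 0)).im) {x | x 0 ∈ Ioo (0 : ℝ) 1728} ∧
      c.domain = {x | x 0 < 0} ∧ EqOn c.integrand (fun x => (G (x 0)).im) {x | x 0 < 0} ∧
      KZ.of a + KZ.of b + KZ.of c ∈ KZ.relations := by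
  set G₂ : ℂ → ℂ := fun u => -Complex.I * G u with hG₂
  have hGc₂ : ContinuousOn G₂ {u : ℂ | u.im ≤ 0 ∧ u ≠ 0 ∧ u ≠ 1728} := continuousOn_const.mul hGc
  have hGd₂ : DifferentiableOn ℂ G₂ {u : ℂ | u.im < 0} := (differentiableOn_const _).mul hGd
  have hGdecay₂ : ∀ ε > 0, ∃ R, ∀ u : ℂ, u.im ≤ 0 → R ≤ ‖u‖ → ‖G₂ u‖ ≤ ε := by
    intro ε hε
    obtain ⟨R, hR⟩ := hGdecay ε hε
    exact ⟨R, fun u hu hRu => by simpa [hG₂] using hR u hu hRu⟩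
  have hGre₂ : IsSemialgebraicFunOn ℚ {w : Fin 2 → ℝ | w 1 ≤ 0 ∧ ¬(w 0 = 0 ∧ w 1 = 0) ∧ ¬(w 0 = 1728 ∧ w 1 = 0)}
      (fun w => (G₂ ((w 0 : ℂ) + (w 1 : ℂ) * Complex.I)).re) :=
    hGim.congr fun w _ => by simp [hG₂]
  have hGim₂ : IsSemialgebraicFunOn ℚ {w : Fin 2 → ℝ | w 1 ≤ 0 ∧ ¬(w 0 = 0 ∧ w 1 = 0) ∧ ¬(w 0 = 1728 ∧ w 1 = 0)}
      (fun w => (G₂ ((w 0 : ℂ) + (w 1 : ℂ) * Complex.I)).im) :=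
    hGre.neg.congr fun w _ => by simp [hG₂]
  have hGint₂ : IntegrableOn (fun w : Fin 2 → ℝ => deriv G₂ ((w 0 : ℂ) + (w 1 : ℂ) * Complex.I)) {w | w 1 < 0} := by
    have h1 : IntegrableOn (fun w : Fin 2 → ℝ => -Complex.I * deriv G ((w 0 : ℂ) + (w 1 : ℂ) * Complex.I)) {w | w 1 < 0} :=
      hGint.const_mul (-Complex.I)
    refine h1.congr_fun (fun w hw => ?_) (measurableSet_lt (measurable_pi_apply 1) measurable_const)
    have hd : DifferentiableAt ℂ G ((w 0 : ℂ) + (w 1 : ℂ) * Complex.I) :=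
      hGd.differentiableAt ((isOpen_lt Complex.continuous_im continuous_const).mem_nhds (by simpa using hw))
    show -Complex.I * deriv G _ = deriv (fun u => -Complex.I * G u) _
    rw [deriv_const_mul _ hd]
  have hIA₂ : IntegrableOn (fun x : Fin 1 → ℝ => G₂ (x 0)) {x | 1728 < x 0} := hIA.const_mul _
  have hIB₂ : IntegrableOn (fun x : Fin 1 → ℝ => G₂ (x 0)) {x | x 0 ∈ Ioo (0 : ℝ) 1728} := hIB.const_mul _
  have hIC₂ : IntegrableOn (fun x : Fin 1 → ℝ => G₂ (x 0)) {x | x 0 < 0} := hIC.const_mul _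
  obtain ⟨a, b, c, ha, hai, hb, hbi, hc, hci, hrel⟩ :=
    cauchy_three_edges_re hGc₂ hGd₂ hGdecay₂ hGre₂ hGim₂ hGint₂ hIA₂ hIB₂ hIC₂
  refine ⟨a, b, c, ha, fun x hx => ?_, hb, fun x hx => ?_, hc, fun x hx => ?_, hrel⟩
  · rw [hai hx]; exact (re_neg_I_mul _).1
  · rw [hbi hx]; exact (re_neg_I_mul _).1
  · rw [hci hx]; exact (re_neg_I_mul _).1

/-- **Cauchy on the lower half plane, negated imaginary parts**: the same three edge representations
with integrands `−im G` (apply `cauchy_three_edges_im` to `−G`; used for the mirror tiles, whose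
integrands are complex conjugates). [cite: KontsevichZagierPeriods2001, §1.2 rules (1)–(3)] -/
theorem cauchy_three_edges_neg_im
    (hGc : ContinuousOn G {u : ℂ | u.im ≤ 0 ∧ u ≠ 0 ∧ u ≠ 1728})
    (hGd : DifferentiableOn ℂ G {u : ℂ | u.im < 0})
    (hGdecay : ∀ ε > 0, ∃ R, ∀ u : ℂ, u.im ≤ 0 → R ≤ ‖u‖ → ‖G u‖ ≤ ε)
    (hGre : IsSemialgebraicFunOn ℚ {w : Fin 2 → ℝ | w 1 ≤ 0 ∧ ¬(w 0 = 0 ∧ w 1 = 0) ∧ ¬(w 0 = 1728 ∧ w 1 = 0)}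
      (fun w => (G ((w 0 : ℂ) + (w 1 : ℂ) * Complex.I)).re))
    (hGim : IsSemialgebraicFunOn ℚ {w : Fin 2 → ℝ | w 1 ≤ 0 ∧ ¬(w 0 = 0 ∧ w 1 = 0) ∧ ¬(w 0 = 1728 ∧ w 1 = 0)}
      (fun w => (G ((w 0 : ℂ) + (w 1 : ℂ) * Complex.I)).im))
    (hGint : IntegrableOn (fun w : Fin 2 → ℝ => deriv G ((w 0 : ℂ) + (w 1 : ℂ) * Complex.I)) {w | w 1 < 0})
    (hIA : IntegrableOn (fun x : Fin 1 → ℝ => G (x 0)) {x | 1728 < x 0})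
    (hIB : IntegrableOn (fun x : Fin 1 → ℝ => G (x 0)) {x | x 0 ∈ Ioo (0 : ℝ) 1728})
    (hIC : IntegrableOn (fun x : Fin 1 → ℝ => G (x 0)) {x | x 0 < 0}) :
    ∃ a b c : KZ.IntegralRep 1,
      a.domain = {x | 1728 < x 0} ∧ EqOn a.integrand (fun x => -(G (x 0)).im) {x | 1728 < x 0} ∧
      b.domain = {x | x 0 ∈ Ioo (0 : ℝ) 1728} ∧ EqOn b.integrand (fun x => -(G (x 0)).im) {x | x 0 ∈ Ioo (0 : ℝ) 1728} ∧
      c.domain = {x | x 0 < 0} ∧ EqOn c.integrand (fun x => -(G (x 0)).im) {x | x 0 < 0} ∧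
      KZ.of a + KZ.of b + KZ.of c ∈ KZ.relations := by
  set G₂ : ℂ → ℂ := fun u => -G u with hG₂
  have hGc₂ : ContinuousOn G₂ {u : ℂ | u.im ≤ 0 ∧ u ≠ 0 ∧ u ≠ 1728} := hGc.neg
  have hGd₂ : DifferentiableOn ℂ G₂ {u : ℂ | u.im < 0} := hGd.neg
  have hGdecay₂ : ∀ ε > 0, ∃ R, ∀ u : ℂ, u.im ≤ 0 → R ≤ ‖u‖ → ‖G₂ u‖ ≤ ε := by
    intro ε hε
    obtain ⟨R, hR⟩ := hGdecay ε hε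
    exact ⟨R, fun u hu hRu => by simpa [hG₂] using hR u hu hRu⟩
  have hGre₂ : IsSemialgebraicFunOn ℚ {w : Fin 2 → ℝ | w 1 ≤ 0 ∧ ¬(w 0 = 0 ∧ w 1 = 0) ∧ ¬(w 0 = 1728 ∧ w 1 = 0)}
      (fun w => (G₂ ((w 0 : ℂ) + (w 1 : ℂ) * Complex.I)).re) :=
    hGre.neg.congr fun w _ => by simp [hG₂]
  have hGim₂ : IsSemialgebraicFunOn ℚ {w : Fin 2 → ℝ | w 1 ≤ 0 ∧ ¬(w 0 = 0 ∧ w 1 = 0) ∧ ¬(w 0 = 1728 ∧ w 1 = 0)}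
      (fun w => (G₂ ((w 0 : ℂ) + (w 1 : ℂ) * Complex.I)).im) :=
    hGim.neg.congr fun w _ => by simp [hG₂]
  have hGint₂ : IntegrableOn (fun w : Fin 2 → ℝ => deriv G₂ ((w 0 : ℂ) + (w 1 : ℂ) * Complex.I)) {w | w 1 < 0} := by
    refine hGint.neg.congr_fun (fun w _ => ?_) (measurableSet_lt (measurable_pi_apply 1) measurable_const)
    show -deriv G _ = deriv (fun u => -G u) _
    rw [deriv.fun_neg]
  obtain ⟨a, b, c, ha, hai, hb, hbi, hc, hci, hrel⟩ :=
    cauchy_three_edges_im hGc₂ hGd₂ hGdecay₂ hGre₂ hGim₂ hGint₂ hIA.neg hIB.neg hIC.neg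
  refine ⟨a, b, c, ha, fun x hx => ?_, hb, fun x hx => ?_, hc, fun x hx => ?_, hrel⟩
  · rw [hai hx]; simp [hG₂]
  · rw [hbi hx]; simp [hG₂]
  · rw [hci hx]; simp [hG₂]

end ThreeEdges

end Summit.KontsevichZagierPeriods.HeckeMultiplicityOne.ManinStokes
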